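import Literature.MathematicalPhysics.PowerSystems.SignedLaplacianInertiaBounds
import HarnessLib

/-!
# The index theorem for signed graph Laplacians on ANY topology: `n₊(ℒ_G) = #{γ_e < 0} − n₊(𝒵_G)`
# with the cycle intersection form `𝒵_G` (Bronski–DeVille–Ferguson 2016, Theorem 2.6)

SOURCE (read on the page; held LaTeX `paper:arxiv-1508.01507` = [BronskiDeVilleFerguson2016],
SIAM J. Appl. Math. 76 (2016) 1126–1151):
* §2.1 (p0005 L20–L63): `(ℒ_G)_{vw} = γ_{vw}` (`v ≠ w`), `−Σ_u γ_{vu}` (`v = w`); spectral index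
  `(n₊, n₀, n₋)`; **Definition 2.2** reduced determinant («`detred(ℒ_G) = 0` iff `ℒ_G` has a nonsimple
  eigenvalue at `0`»); **Definition 2.3** signed incidence matrix `B_G` (|V| × |E|), cycle space
  `= ker B_G` of dimension «`C := |E(G)| − |V(G)| + 1`», «`ker(B_Gᵀ) = Span(𝟏)` whenever `G` is
  connected»; **Definition 2.4** (p0005 L64–L87): `Y_G` = a basis of the cycle space as columns,
  `D_G = diag(γ_e)`, the CYCLE INTERSECTION MATRIX «`𝒵_G := −Y_Gᵀ D_G⁻¹ Y_G`,
  `(𝒵_G)_{ij} = −Σ_e γ_e⁻¹ y_{i,e} y_{j,e}`»; **Lemma 2.5** (p0005 L88–L112) `ℒ_G = −B_G D_G B_Gᵀ`.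
* §2.2 **Theorem 2.6** (p0005 L116–L134): «Let `G = (V, E, Γ)` be a connected, weighted graph and
  let `ℒ_G` be its Laplacian matrix. Then the number of positive eigenvalues of the Laplacian is the
  number of negative edges in the graph minus the number of positive eigenvalues of the cycle
  intersection matrix, i.e. `n₊(ℒ_G) = #{e ∈ E | γ_e < 0} − n₊(𝒵_G)`.» … «it follows from Lemma
  (sylvester) that the index of `𝒵_G` is independent of this choice of basis»; eq. (LZ)
  «`n₊(ℒ(G)) ≥ #{e ∈ E | γ_e < 0} − C`» and p0006 L1–L8 «the maximal number of negative edges a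
  graph can have and still have a stable Laplacian is the cycle number `C`»; Remark 2.7;
  **Theorem 2.8** (p0006 L56–L68) `detred(ℒ_G)/N_G = det(𝒵(G)) Π_e γ_e`.
* §5 proof of Theorem 2.6 (p0012 L100–L131) via §6 **Lemma 6.1 (Haynsworth)** (p0014 L5–L20):
  «Suppose that `M` is a non-singular `N × N` Hermitian matrix … If `M|_S` is non-singular, then
  `n₊(M) = n₊(M|_S) + n₊((M⁻¹)|_{S^⊥})`».
* §1.1 (p0003 L82–L110): the Kuramoto / power-grid reading (dimension of the unstable manifold of
  a phase-locked solution = number of positive eigenvalues of the Jacobian `ℒ`).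

RENDERING.  Everything is linear algebra over three finite index types: nodes `V`, edges `E`,
cycles `κ`.  The graph enters through HYPOTHESES on a node–edge matrix `B : Matrix V E ℝ` (for
the signed incidence matrix of a connected graph: `ker Bᵀ` = the constants, `hconn` + `hone`) and
an edge–cycle matrix `C : Matrix E κ ℝ` (a basis of the cycle space as columns: `BC = 0`,
injective, spanning `ker B` — `hBC`, `hCinj`, `hcyc`); non-zero weights `γ : E → ℝ`.  As in the
sibling files the matrices are CARRIERS of forms: `H` real symmetric with `xᵀHx = Σ_e γ_e (Bᵀx)_e²`
(`H = B D Bᵀ = −ℒ_G`, the Hessian sign; `n₊(ℒ_G) = n₋(H)`), `Z` real symmetric with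
`yᵀZy = Σ_e (Cy)_e²/γ_e` (`Z = CᵀD⁻¹C = −𝒵_G`; `n₊(𝒵_G) = n₋(Z)`).  The print's Theorem 2.6 carries
no non-degeneracy hypothesis, but its proof uses Lemma 6.1 whose hypothesis `M|_S` non-singular is
`det 𝒵_G ≠ 0` (equivalently, by Theorem 2.8, a simple zero of `ℒ_G`); we state the identity under
`n₀(Z) = 0` and prove the unconditional INEQUALITIES separately.  No definitions.

WHAT IS PROVED (namespace `Literature.MathematicalPhysics.PowerSystems`; 0 `def`, 0 named facts,
0 `sorry`):
* ★ `CycleIntersection.card_pos_add_card_pos_le` / `card_neg_add_card_neg_le` — for ANY `B`, `C`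
  with `BC = 0`: `n₊(H) + n₊(Z) ≤ #{γ_e > 0}`, `n₋(H) + n₋(Z) ≤ #{γ_e < 0}` (the images of the
  positive eigenvectors under `Bᵀ` and `D⁻¹C` are `D`-orthogonal and `D`-positive);
  ★★ `card_add_card_le` (both).
* `CycleIntersection.mulVec_eq_incidence` (`Hx = BDBᵀx`, Lemma 2.5 by polarization),
  `mulVec_eq_cycle`; ★ `ker_const_of_cycleForm_regular` (`Z` non-singular ⇒ `ker H` = constants);
  `card_edges_add_one` — the CYCLE RANK `|E| + 1 = |V| + |κ|` DERIVED from the hypotheses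
  (rank–nullity and `rank B = rank Bᵀ`).
* ★★★ `CycleIntersection.index_theorem` — `Z` non-singular ⇒ `n₋(H) + n₋(Z) = #{γ_e < 0}`,
  `n₊(H) + n₊(Z) = #{γ_e > 0}`, `n₀(H) = 1`; ★★★ `card_neg_eq_card_negEdges_sub` — THEOREM 2.6 as
  printed (`n₋(H) = #{γ_e < 0} − n₋(Z)`), its mirror, the simple zero and eq. (LZ).
* MODEL (`NonuniformKuramoto`, `ClassicalModel.LosslessSystem`):
  ★★★ `type_eq_card_longLines_sub_cycleIndex` (both tiers) — with the linearised network given as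
  an oriented weighted edge list `(B, γ)`, `γ_e = P_e cos(θ_i − θ_j)`, a cycle basis `C` and the cycle
  intersection matrix `Z` non-singular: TYPE `= #{long lines} − n₋(Z)`, LHP `= #{short lines} −
  n₊(Z)` (`+ N` swing), axis `1`; `#{long lines} ≤ type + C`.

PROOF ROUTE (ours; the source uses a covering tree, Lemmas 5.x, Sylvester and Haynsworth): directly
on the edge space `ℝ^E` with `M = D`: the columns `Bᵀu_i` (`u_i` positive eigenvectors of `H`) and
`D⁻¹Cw_k` (`w_k` positive eigenvectors of `Z`) give a matrix `V` with `(Vc)ᵀD(Vc) = xᵀHx + yᵀZy > 0`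
for `c ≠ 0` (`dform_split`, cross term `2xᵀBCy = 0`), so the tree's subspace count
`EigenvalueCount.card_le_card_eigenvalues_gt` gives `n₊(H) + n₊(Z) ≤ n₊(D) = #{γ_e > 0}`
(`card_eigenvalues_gt_eq_card_pos` for the diagonal `D`); mirror for negatives; `Z` non-singular
forces `ker H ⊆` constants (so `n₀(H) = 1`: two orthonormal constant vectors cannot coexist, and
`H𝟏 = 0`), and the totals `|V| + |κ| = |E| + 1` close both inequalities to equalities.

NOT CLAIMED: the converse `n₀(H) = 1 ⇒ det Z ≠ 0` and Theorem 2.8 (the determinant identity /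
tree-complement generating function); Remark 2.7's block form; basis-independence as a separate
statement (it is implicit: the identities hold for EVERY admissible `C`); §3's examples are the
sibling files (`SignedCycleInertia` = the ring, `TreeNetworkFixedPointIndex` = `C = 0`).

## References
* [BronskiDeVilleFerguson2016] J. C. Bronski, L. DeVille, T. Ferguson, *Graph homology and
  stability of coupled oscillator networks*, SIAM J. Appl. Math. 76 (2016) 1126–1151,
  doi:10.1137/15m1034258, arXiv:1508.01507 — §1.1, §2.1 Defs 2.2–2.4, Lemma 2.5, §2.2 Thm 2.6,
  (LZ), Rem 2.7, Thm 2.8, §5, §6 Lemma 6.1.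
* [HornJohnson2013] R. A. Horn, C. R. Johnson, *Matrix Analysis*, 2nd ed., CUP 2013 — Thm 4.2.6 /
  (4.2.12) (the tree's subspace counts), 4.5.P21 (Haynsworth).
* [Chiang1995] H.-D. Chiang, in: Systems and Control Theory for Power Systems, IMA 64 (1995) 39–93
  — §6 Theorems 6.1, 6.7 (the tree's type-count bridge).
-/

noncomputable section

open scoped Matrix
open Finset Matrix

namespace Literature.MathematicalPhysics.PowerSystems

namespace CycleIntersection

open Literature.Analysis.Matrix (KyFan.dotProduct_mulVec_eq_sum_eigen KyFan.dotProduct_self_eq_sum_sq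
  KyFan.eigenvectorBasis_dotProduct)

/-! ### §1. Combinations of selected eigenvectors -/

section Eigen

variable {ι : Type*} [Fintype ι] [DecidableEq ι] {W : Matrix ι ι ℝ}

/-- The `a`-th eigen-coordinate of `Σ_{j : p j} c_j u_j` is `c_a` if `p a`, else `0`. [folklore] -/
private theorem coord_comb (hW : W.IsHermitian) (p : ι → Prop) [DecidablePred p]
    (c : {j // p j} → ℝ) (a : ι) :
    (hW.eigenvectorBasis a).ofLp ⬝ᵥ (∑ j : {j // p j}, c j • (hW.eigenvectorBasis j.1).ofLp)
      = if h : p a then c ⟨a, h⟩ else 0 := by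
  rw [dotProduct_sum]
  simp_rw [dotProduct_smul, smul_eq_mul, KyFan.eigenvectorBasis_dotProduct hW]
  by_cases h : p a
  · rw [dif_pos h, Finset.sum_eq_single ⟨a, h⟩]
    · simp
    · intro j _ hj
      have : a ≠ j.1 := fun h' => hj (Subtype.ext h'.symm)
      simp [this]
    · simp
  · rw [dif_neg h]
    refine Finset.sum_eq_zero fun j _ => ?_
    have : a ≠ j.1 := fun h' => h (h' ▸ j.2)
    simp [this]

/-- The form of `W` on `Σ_{p j} c_j u_j` is `Σ_{p j} λ_j c_j²`. [folklore] -/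
private theorem form_comb (hW : W.IsHermitian) (p : ι → Prop) [DecidablePred p]
    (c : {j // p j} → ℝ) :
    (∑ j : {j // p j}, c j • (hW.eigenvectorBasis j.1).ofLp) ⬝ᵥ W *ᵥ
        (∑ j : {j // p j}, c j • (hW.eigenvectorBasis j.1).ofLp)
      = ∑ j : {j // p j}, hW.eigenvalues j.1 * c j ^ 2 := by
  rw [KyFan.dotProduct_mulVec_eq_sum_eigen hW]
  simp_rw [coord_comb hW p c]
  rw [← Fintype.sum_subtype_add_sum_subtype p]
  have h0 : ∑ a : {a // ¬ p a}, hW.eigenvalues a.1 * (if h : p a.1 then c ⟨a.1, h⟩ else 0) ^ 2 = 0 :=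
    Finset.sum_eq_zero fun a _ => by simp [dif_neg a.2]
  rw [h0, add_zero]
  exact Finset.sum_congr rfl fun j _ => by rw [dif_pos j.2]

/-- A non-trivial combination of eigenvectors with POSITIVE eigenvalues has positive form. [folklore] -/
private theorem form_comb_pos (hW : W.IsHermitian) {c : {j // 0 < hW.eigenvalues j} → ℝ}
    (hc : c ≠ 0) :
    0 < (∑ j : {j // 0 < hW.eigenvalues j}, c j • (hW.eigenvectorBasis j.1).ofLp) ⬝ᵥ W *ᵥ
        (∑ j : {j // 0 < hW.eigenvalues j}, c j • (hW.eigenvectorBasis j.1).ofLp) := by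
  rw [form_comb hW (fun j => 0 < hW.eigenvalues j) c]
  obtain ⟨j, hj⟩ : ∃ j, c j ≠ 0 := by
    by_contra h
    push Not at h
    exact hc (funext h)
  exact Finset.sum_pos' (fun i _ => mul_nonneg i.2.le (sq_nonneg _))
    ⟨j, Finset.mem_univ _, mul_pos j.2 (by positivity)⟩

/-- A non-trivial combination of eigenvectors with NEGATIVE eigenvalues has negative form. [folklore] -/
private theorem form_comb_neg (hW : W.IsHermitian) {c : {j // hW.eigenvalues j < 0} → ℝ}
    (hc : c ≠ 0) :
    (∑ j : {j // hW.eigenvalues j < 0}, c j • (hW.eigenvectorBasis j.1).ofLp) ⬝ᵥ W *ᵥ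
        (∑ j : {j // hW.eigenvalues j < 0}, c j • (hW.eigenvectorBasis j.1).ofLp) < 0 := by
  rw [form_comb hW (fun j => hW.eigenvalues j < 0) c]
  obtain ⟨j, hj⟩ : ∃ j, c j ≠ 0 := by
    by_contra h
    push Not at h
    exact hc (funext h)
  exact Finset.sum_neg' (fun i _ => mul_nonpos_iff.2 (Or.inr ⟨i.2.le, sq_nonneg _⟩))
    ⟨j, Finset.mem_univ _, mul_neg_of_neg_of_pos j.2 (by positivity)⟩

/-- A combination of distinct eigenvectors vanishes iff all coefficients vanish. [folklore] -/
private theorem comb_eq_zero_iff (hW : W.IsHermitian) (p : ι → Prop) [DecidablePred p]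
    (c : {j // p j} → ℝ) :
    (∑ j : {j // p j}, c j • (hW.eigenvectorBasis j.1).ofLp) = 0 ↔ c = 0 := by
  constructor
  · intro h
    funext j
    have := coord_comb hW p c j.1
    rw [h, dotProduct_zero, dif_pos j.2] at this
    simpa using this.symm
  · intro h
    subst h
    simp

end Eigen

/-! ### §2. The eigenvalue counts of a non-singular diagonal matrix -/

section Diagonal

variable {E : Type*} [Fintype E] [DecidableEq E]

/-- `#{λ(diag γ) > 0} = #{e | γ_e > 0}` (all `γ_e ≠ 0`). [folklore] -/
private theorem card_pos_diagonal {γ : E → ℝ} (hγ : ∀ e, γ e ≠ 0)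
    (hD : (Matrix.diagonal γ).IsHermitian) :
    (univ.filter fun e => 0 < hD.eigenvalues e).card = (univ.filter fun e => 0 < γ e).card := by
  have h := Literature.Analysis.Matrix.EigenvalueCount.card_eigenvalues_gt_eq_card_pos hD
    (S := 1) (θ := 0) (d := γ) (by rw [Matrix.det_one]; exact isUnit_one) (by simp) hγ
  rw [h, Fintype.card_subtype]

/-- `#{λ(diag γ) < 0} = #{e | γ_e < 0}` (all `γ_e ≠ 0`). [folklore] -/
private theorem card_neg_diagonal {γ : E → ℝ} (hγ : ∀ e, γ e ≠ 0)
    (hD : (Matrix.diagonal γ).IsHermitian) :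
    (univ.filter fun e => hD.eigenvalues e < 0).card = (univ.filter fun e => γ e < 0).card := by
  have h := Literature.Analysis.Matrix.EigenvalueCount.card_eigenvalues_lt_eq_card_neg hD
    (S := 1) (θ := 0) (d := γ) (by rw [Matrix.det_one]; exact isUnit_one) (by simp) hγ
  rw [h, Fintype.card_subtype]

end Diagonal

/-! ### §3. The setting: an edge space `E` with non-zero weights `γ`, the "incidence" `B` (nodes × edges),
a "cycle matrix" `C` (edges × cycles) with `BC = 0`, a carrier `H` of the cut form `Σ_e γ_e (Bᵀx)_e²`
(`= B D Bᵀ = −ℒ_G`) and a carrier `Z` of the cycle form `Σ_e (Cy)_e² / γ_e` (`= Cᵀ D⁻¹ C = −𝒵_G`) -/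

section Counts

variable {V E κ : Type*} [Fintype V] [DecidableEq V] [Fintype E] [DecidableEq E]
  [Fintype κ] [DecidableEq κ]

omit [DecidableEq V] [DecidableEq E] [DecidableEq κ] in
/-- **`D`-orthogonality of the cut and cycle directions**: for `f = Bᵀx + D⁻¹Cy`,
`fᵀDf = xᵀ(BDBᵀ)x + yᵀ(CᵀD⁻¹C)y` — the cross term is `2xᵀBCy = 0`. [folklore] -/
private theorem dform_split {γ : E → ℝ} (hγ : ∀ e, γ e ≠ 0) (B : Matrix V E ℝ) (C : Matrix E κ ℝ)
    (hBC : B * C = 0) (x : V → ℝ) (y : κ → ℝ) :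
    ∑ e, γ e * ((Bᵀ *ᵥ x) e + (C *ᵥ y) e / γ e) ^ 2
      = ∑ e, γ e * ((Bᵀ *ᵥ x) e) ^ 2 + ∑ e, ((C *ᵥ y) e) ^ 2 / γ e := by
  have hcross : ∑ e, (Bᵀ *ᵥ x) e * (C *ᵥ y) e = 0 := by
    have : (Bᵀ *ᵥ x) ⬝ᵥ (C *ᵥ y) = 0 := by
      rw [mulVec_transpose, ← dotProduct_mulVec, mulVec_mulVec, hBC, zero_mulVec, dotProduct_zero]
    simpa [dotProduct] using this
  have hterm : ∀ e, γ e * ((Bᵀ *ᵥ x) e + (C *ᵥ y) e / γ e) ^ 2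
      = γ e * ((Bᵀ *ᵥ x) e) ^ 2 + 2 * ((Bᵀ *ᵥ x) e * (C *ᵥ y) e) + ((C *ᵥ y) e) ^ 2 / γ e := by
    intro e
    have h := hγ e
    field_simp
    ring
  simp_rw [hterm]
  rw [Finset.sum_add_distrib, Finset.sum_add_distrib, ← Finset.mul_sum, hcross, mul_zero, add_zero]

omit [DecidableEq V] [DecidableEq E] [DecidableEq κ] in
/-- The `D`-form `Σ_e γ_e f_e²` is the quadratic form of `diagonal γ`. [folklore] -/
private theorem dform_eq (γ : E → ℝ) [DecidableEq E] (f : E → ℝ) :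
    f ⬝ᵥ Matrix.diagonal γ *ᵥ f = ∑ e, γ e * f e ^ 2 := by
  simp only [dotProduct, mulVec_diagonal]
  exact Finset.sum_congr rfl fun e _ => by ring

/-- A matrix of eigenvector columns turns coefficient vectors into the combination. [folklore] -/
private theorem cols_mulVec {ι : Type*} [Fintype ι] [DecidableEq ι] {W : Matrix ι ι ℝ}
    (hW : W.IsHermitian) (p : ι → Prop) [DecidablePred p] (c : {j // p j} → ℝ) :
    (Matrix.of fun v (j : {j // p j}) => (hW.eigenvectorBasis j.1).ofLp v) *ᵥ c
      = ∑ j : {j // p j}, c j • (hW.eigenvectorBasis j.1).ofLp := by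
  funext v
  simp only [mulVec, dotProduct, Matrix.of_apply, Finset.sum_apply, Pi.smul_apply, smul_eq_mul]
  exact Finset.sum_congr rfl fun j _ => mul_comm _ _

/-- ★ **The positive count** (the core of Theorem 2.6): `n₊(BDBᵀ) + n₊(CᵀD⁻¹C) ≤ #{e | γ_e > 0}` —
the images under `Bᵀ` of the positive eigenvectors of `H` and under `D⁻¹C` of those of `Z` span a
`D`-positive subspace of the edge space of the full dimension (the two pieces are `D`-orthogonal
because `BC = 0`), and `D = diag(γ)` has exactly `#{γ_e > 0}` positive eigenvalues (the counting
form of Haynsworth's theorem `n₊(M) = n₊(M|_S) + n₊(M⁻¹|_{S^⊥})` used in the source, Lemma 6.1).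
[cite: BronskiDeVilleFerguson2016, §2.2 Theorem 2.6 with §6 Lemma 6.1 (Haynsworth) and §5 proof of Theorem 2.6 (arXiv:1508.01507 p0005 L116–L134, p0012 L100–L131, p0014 L5–L20)] -/
theorem card_pos_add_card_pos_le {γ : E → ℝ} (hγ : ∀ e, γ e ≠ 0) (B : Matrix V E ℝ)
    (C : Matrix E κ ℝ) (hBC : B * C = 0) {H : Matrix V V ℝ} (hH : H.IsHermitian)
    (hHform : ∀ x : V → ℝ, x ⬝ᵥ H *ᵥ x = ∑ e, γ e * ((Bᵀ *ᵥ x) e) ^ 2)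
    {Z : Matrix κ κ ℝ} (hZ : Z.IsHermitian)
    (hZform : ∀ y : κ → ℝ, y ⬝ᵥ Z *ᵥ y = ∑ e, ((C *ᵥ y) e) ^ 2 / γ e) :
    (univ.filter fun i => 0 < hH.eigenvalues i).card + (univ.filter fun k => 0 < hZ.eigenvalues k).card
      ≤ (univ.filter fun e => 0 < γ e).card := by
  classical
  have hD : (Matrix.diagonal γ).IsHermitian := Matrix.isHermitian_diagonal_of_self_adjoint γ
    (funext fun _ => by simp)
  -- columns: `Bᵀ u_i` (positive eigenvectors of `H`) and `D⁻¹ C w_k` (positive eigenvectors of `Z`)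
  set U : Matrix V {i // 0 < hH.eigenvalues i} ℝ :=
    Matrix.of fun v i => (hH.eigenvectorBasis i.1).ofLp v with hU
  set Wm : Matrix κ {k // 0 < hZ.eigenvalues k} ℝ :=
    Matrix.of fun v k => (hZ.eigenvectorBasis k.1).ofLp v with hWm
  set M : Matrix E ({i // 0 < hH.eigenvalues i} ⊕ {k // 0 < hZ.eigenvalues k}) ℝ :=
    Matrix.fromCols (Bᵀ * U) (Matrix.diagonal (fun e => (γ e)⁻¹) * (C * Wm)) with hM
  have key := Literature.Analysis.Matrix.EigenvalueCount.card_le_card_eigenvalues_gt hD M (θ := 0)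
    (fun c hc => ?_)
  · rw [Fintype.card_sum, Fintype.card_subtype, Fintype.card_subtype, card_pos_diagonal hγ hD] at key
    exact key
  · -- the test vector `f = Bᵀx + D⁻¹Cy`
    set x : V → ℝ := ∑ i : {i // 0 < hH.eigenvalues i}, (c ∘ Sum.inl) i • (hH.eigenvectorBasis i.1).ofLp
      with hx
    set y : κ → ℝ := ∑ k : {k // 0 < hZ.eigenvalues k}, (c ∘ Sum.inr) k • (hZ.eigenvectorBasis k.1).ofLp
      with hy
    have hMc : M *ᵥ c = fun e => (Bᵀ *ᵥ x) e + (C *ᵥ y) e / γ e := by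
      rw [hM, Matrix.fromCols_mulVec, ← mulVec_mulVec, ← mulVec_mulVec, ← mulVec_mulVec, hU, hWm,
        cols_mulVec hH _ (c ∘ Sum.inl), cols_mulVec hZ _ (c ∘ Sum.inr), ← hx, ← hy]
      funext e
      simp only [Pi.add_apply, mulVec_diagonal]
      rw [div_eq_inv_mul]
    rw [zero_mul, hMc, dform_eq, dform_split hγ B C hBC x y, ← hHform, ← hZform]
    -- `c ≠ 0`: one of the two coefficient blocks is non-zero
    by_cases h1 : c ∘ Sum.inl = 0
    · have h2 : c ∘ Sum.inr ≠ 0 := by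
        intro h2
        apply hc
        funext s
        rcases s with i | k
        · exact congrFun h1 i
        · exact congrFun h2 k
      have hx0 : x = 0 := by
        rw [hx]
        exact (comb_eq_zero_iff hH _ _).2 h1
      rw [hx0, mulVec_zero, dotProduct_zero, zero_add, hy]
      exact form_comb_pos hZ h2
    · have hxpos : 0 < x ⬝ᵥ H *ᵥ x := by rw [hx]; exact form_comb_pos hH h1
      have hynn : 0 ≤ y ⬝ᵥ Z *ᵥ y := by
        rw [hy, form_comb hZ (fun k => 0 < hZ.eigenvalues k)]
        exact Finset.sum_nonneg fun k _ => mul_nonneg k.2.le (sq_nonneg _)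
      linarith

/-- ★ **The negative count**: `n₋(BDBᵀ) + n₋(CᵀD⁻¹C) ≤ #{e | γ_e < 0}`.
[cite: BronskiDeVilleFerguson2016, §2.2 Theorem 2.6 with §6 Lemma 6.1 (arXiv:1508.01507 p0005 L116–L134, p0014 L5–L20)] -/
theorem card_neg_add_card_neg_le {γ : E → ℝ} (hγ : ∀ e, γ e ≠ 0) (B : Matrix V E ℝ)
    (C : Matrix E κ ℝ) (hBC : B * C = 0) {H : Matrix V V ℝ} (hH : H.IsHermitian)
    (hHform : ∀ x : V → ℝ, x ⬝ᵥ H *ᵥ x = ∑ e, γ e * ((Bᵀ *ᵥ x) e) ^ 2)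
    {Z : Matrix κ κ ℝ} (hZ : Z.IsHermitian)
    (hZform : ∀ y : κ → ℝ, y ⬝ᵥ Z *ᵥ y = ∑ e, ((C *ᵥ y) e) ^ 2 / γ e) :
    (univ.filter fun i => hH.eigenvalues i < 0).card + (univ.filter fun k => hZ.eigenvalues k < 0).card
      ≤ (univ.filter fun e => γ e < 0).card := by
  classical
  have hD : (Matrix.diagonal γ).IsHermitian := Matrix.isHermitian_diagonal_of_self_adjoint γ
    (funext fun _ => by simp)
  set U : Matrix V {i // hH.eigenvalues i < 0} ℝ :=
    Matrix.of fun v i => (hH.eigenvectorBasis i.1).ofLp v with hU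
  set Wm : Matrix κ {k // hZ.eigenvalues k < 0} ℝ :=
    Matrix.of fun v k => (hZ.eigenvectorBasis k.1).ofLp v with hWm
  set M : Matrix E ({i // hH.eigenvalues i < 0} ⊕ {k // hZ.eigenvalues k < 0}) ℝ :=
    Matrix.fromCols (Bᵀ * U) (Matrix.diagonal (fun e => (γ e)⁻¹) * (C * Wm)) with hM
  have key := Literature.Analysis.Matrix.EigenvalueCount.card_le_card_eigenvalues_lt hD M (θ := 0)
    (fun c hc => ?_)
  · rw [Fintype.card_sum, Fintype.card_subtype, Fintype.card_subtype, card_neg_diagonal hγ hD] at key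
    exact key
  · set x : V → ℝ := ∑ i : {i // hH.eigenvalues i < 0}, (c ∘ Sum.inl) i • (hH.eigenvectorBasis i.1).ofLp
      with hx
    set y : κ → ℝ := ∑ k : {k // hZ.eigenvalues k < 0}, (c ∘ Sum.inr) k • (hZ.eigenvectorBasis k.1).ofLp
      with hy
    have hMc : M *ᵥ c = fun e => (Bᵀ *ᵥ x) e + (C *ᵥ y) e / γ e := by
      rw [hM, Matrix.fromCols_mulVec, ← mulVec_mulVec, ← mulVec_mulVec, ← mulVec_mulVec, hU, hWm,
        cols_mulVec hH _ (c ∘ Sum.inl), cols_mulVec hZ _ (c ∘ Sum.inr), ← hx, ← hy]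
      funext e
      simp only [Pi.add_apply, mulVec_diagonal]
      rw [div_eq_inv_mul]
    rw [zero_mul, hMc, dform_eq, dform_split hγ B C hBC x y, ← hHform, ← hZform]
    by_cases h1 : c ∘ Sum.inl = 0
    · have h2 : c ∘ Sum.inr ≠ 0 := by
        intro h2
        apply hc
        funext s
        rcases s with i | k
        · exact congrFun h1 i
        · exact congrFun h2 k
      have hx0 : x = 0 := by
        rw [hx]
        exact (comb_eq_zero_iff hH _ _).2 h1
      rw [hx0, mulVec_zero, dotProduct_zero, zero_add, hy]
      exact form_comb_neg hZ h2
    · have hxneg : x ⬝ᵥ H *ᵥ x < 0 := by rw [hx]; exact form_comb_neg hH h1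
      have hynp : y ⬝ᵥ Z *ᵥ y ≤ 0 := by
        rw [hy, form_comb hZ (fun k => hZ.eigenvalues k < 0)]
        exact Finset.sum_nonpos fun k _ => mul_nonpos_iff.2 (Or.inr ⟨k.2.le, sq_nonneg _⟩)
      linarith

end Counts

/-! ### §4. The kernel: `ℒ_G` has a simple zero iff the cycle form is non-singular (one direction),
and the dimension identity `|E| + 1 = |V| + C` -/

section Kernel

variable {V E κ : Type*} [Fintype V] [DecidableEq V] [Fintype E] [DecidableEq E]
  [Fintype κ] [DecidableEq κ]

omit [DecidableEq V] [DecidableEq E] [Fintype κ] [DecidableEq κ] in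
/-- **The matrix behind the form**: a real symmetric carrier of `Σ_e γ_e (Bᵀx)_e²` acts as
`Hx = B D Bᵀ x` (Lemma 2.5, `ℒ_G = −B_G D_G B_Gᵀ`, through polarization).
[cite: BronskiDeVilleFerguson2016, §2.1 Lemma 2.5 (arXiv:1508.01507 p0005 L88–L112)] -/
theorem mulVec_eq_incidence {γ : E → ℝ} (B : Matrix V E ℝ) {H : Matrix V V ℝ} (hH : H.IsHermitian)
    (hHform : ∀ x : V → ℝ, x ⬝ᵥ H *ᵥ x = ∑ e, γ e * ((Bᵀ *ᵥ x) e) ^ 2) (x : V → ℝ) :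
    H *ᵥ x = B *ᵥ (fun e => γ e * (Bᵀ *ᵥ x) e) := by
  have hT : Hᵀ = H := Literature.Analysis.Matrix.KyFan.transpose_eq hH
  have hsymm : ∀ z w : V → ℝ, z ⬝ᵥ H *ᵥ w = w ⬝ᵥ H *ᵥ z := by
    intro z w
    rw [dotProduct_mulVec, ← mulVec_transpose, hT, dotProduct_comm]
  -- polarization
  have hbil : ∀ z : V → ℝ, z ⬝ᵥ H *ᵥ x = ∑ e, γ e * ((Bᵀ *ᵥ z) e * (Bᵀ *ᵥ x) e) := by
    intro z
    have h1 := hHform (z + x)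
    rw [mulVec_add, dotProduct_add, add_dotProduct, add_dotProduct, hsymm x z, hHform z, hHform x,
      mulVec_add] at h1
    have h2 : ∑ e, γ e * ((Bᵀ *ᵥ z + Bᵀ *ᵥ x) e) ^ 2
        = ∑ e, γ e * ((Bᵀ *ᵥ z) e) ^ 2 + 2 * ∑ e, γ e * ((Bᵀ *ᵥ z) e * (Bᵀ *ᵥ x) e)
          + ∑ e, γ e * ((Bᵀ *ᵥ x) e) ^ 2 := by
      rw [Finset.mul_sum, ← Finset.sum_add_distrib, ← Finset.sum_add_distrib]
      exact Finset.sum_congr rfl fun e _ => by simp only [Pi.add_apply]; ring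
    linarith
  have hbil' : ∀ z : V → ℝ, z ⬝ᵥ H *ᵥ x = z ⬝ᵥ B *ᵥ (fun e => γ e * (Bᵀ *ᵥ x) e) := by
    intro z
    rw [hbil z, dotProduct_mulVec z B, ← mulVec_transpose]
    simp only [dotProduct]
    exact Finset.sum_congr rfl fun e _ => by ring
  -- `v ⬝ (Hx − Bg) = 0` for all `v`, hence `Hx = Bg`
  have h0 : (H *ᵥ x - B *ᵥ fun e => γ e * (Bᵀ *ᵥ x) e)
      ⬝ᵥ (H *ᵥ x - B *ᵥ fun e => γ e * (Bᵀ *ᵥ x) e) = 0 := by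
    rw [dotProduct_sub, hbil', sub_self]
  exact sub_eq_zero.1 (dotProduct_self_eq_zero.1 h0)

omit [DecidableEq E] [Fintype V] [DecidableEq V] [DecidableEq κ] in
/-- The same for the cycle form: a symmetric carrier of `Σ_e (Cy)_e²/γ_e` acts as `Zy = CᵀD⁻¹Cy`.
[cite: BronskiDeVilleFerguson2016, §2.1 Definition 2.4, eq. (defofZ) (arXiv:1508.01507 p0005 L64–L80)] -/
theorem mulVec_eq_cycle {γ : E → ℝ} (C : Matrix E κ ℝ) {Z : Matrix κ κ ℝ} (hZ : Z.IsHermitian)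
    (hZform : ∀ y : κ → ℝ, y ⬝ᵥ Z *ᵥ y = ∑ e, ((C *ᵥ y) e) ^ 2 / γ e) (y : κ → ℝ) :
    Z *ᵥ y = Cᵀ *ᵥ (fun e => (C *ᵥ y) e / γ e) := by
  have hform' : ∀ y : κ → ℝ, y ⬝ᵥ Z *ᵥ y = ∑ e, (γ e)⁻¹ * ((Cᵀᵀ *ᵥ y) e) ^ 2 := by
    intro y
    rw [hZform, transpose_transpose]
    exact Finset.sum_congr rfl fun e _ => by rw [div_eq_inv_mul]
  rw [mulVec_eq_incidence Cᵀ hZ hform' y, transpose_transpose]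
  congr 1
  funext e
  rw [div_eq_inv_mul]

omit [DecidableEq V] [DecidableEq E] [DecidableEq κ] in
/-- ★ **A non-singular cycle form forces a simple zero**: if `Z = CᵀD⁻¹C` is non-singular (the
columns of `C` independent and spanning `ker B`, only the constants in `ker Bᵀ` — the connected
graph) then every kernel vector of `H = BDBᵀ` is constant (`detred(ℒ_G) ≠ 0 ⇔ det 𝒵 ≠ 0`, the
kernel reading of Theorem 2.8 / Definition 2.2's remark «`detred(ℒ_G) = 0` iff `ℒ_G` has a
nonsimple eigenvalue at `0`»; here the direction used by Theorem 2.6).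
[cite: BronskiDeVilleFerguson2016, §2.1 Definition 2.2 (detred) and Definition 2.3 («`ker(B_Gᵀ) = Span(𝟏)` whenever `G` is connected», cycle space), §2.2 Theorem 2.8 (arXiv:1508.01507 p0005 L25–L63, p0006 L56–L68)] -/
theorem ker_const_of_cycleForm_regular {γ : E → ℝ} (hγ : ∀ e, γ e ≠ 0) (B : Matrix V E ℝ)
    (C : Matrix E κ ℝ) (hBC : B * C = 0)
    (hcyc : ∀ f : E → ℝ, B *ᵥ f = 0 → ∃ y : κ → ℝ, C *ᵥ y = f)
    (hconn : ∀ x : V → ℝ, Bᵀ *ᵥ x = 0 → ∃ c : ℝ, x = fun _ => c)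
    {H : Matrix V V ℝ} (hH : H.IsHermitian)
    (hHform : ∀ x : V → ℝ, x ⬝ᵥ H *ᵥ x = ∑ e, γ e * ((Bᵀ *ᵥ x) e) ^ 2)
    {Z : Matrix κ κ ℝ} (hZ : Z.IsHermitian)
    (hZform : ∀ y : κ → ℝ, y ⬝ᵥ Z *ᵥ y = ∑ e, ((C *ᵥ y) e) ^ 2 / γ e)
    (hZreg : ∀ y : κ → ℝ, Z *ᵥ y = 0 → y = 0) {x : V → ℝ} (hx : H *ᵥ x = 0) :
    ∃ c : ℝ, x = fun _ => c := by
  -- `g = D Bᵀ x` lies in `ker B = range C`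
  rw [mulVec_eq_incidence B hH hHform x] at hx
  obtain ⟨y, hy⟩ := hcyc _ hx
  -- `Z y = Cᵀ Bᵀ x = 0`
  have hZy : Z *ᵥ y = 0 := by
    rw [mulVec_eq_cycle C hZ hZform y, hy]
    have : (fun e => γ e * (Bᵀ *ᵥ x) e / γ e) = Bᵀ *ᵥ x := by
      funext e
      rw [mul_div_assoc, mul_div_cancel₀ _ (hγ e)]
    rw [this, mulVec_mulVec, ← transpose_mul, hBC, transpose_zero, zero_mulVec]
  have hy0 : y = 0 := hZreg y hZy
  rw [hy0, mulVec_zero] at hy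
  -- hence `Bᵀ x = 0` and `x` is constant
  refine hconn x (funext fun e => ?_)
  have := congrFun hy e
  simp only [Pi.zero_apply] at this
  rcases mul_eq_zero.1 this.symm with h | h
  · exact absurd h (hγ e)
  · simpa using h

omit [DecidableEq E] in
/-- If every kernel vector of a real symmetric `H` is constant then `0` has multiplicity `≤ 1`:
two orthonormal eigenvectors cannot both be constant. [folklore] -/
private theorem card_zero_le_one {H : Matrix V V ℝ} (hH : H.IsHermitian)
    (hker : ∀ x : V → ℝ, H *ᵥ x = 0 → ∃ c : ℝ, x = fun _ => c) :
    (univ.filter fun i => hH.eigenvalues i = 0).card ≤ 1 := by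
  refine Finset.card_le_one.2 fun i hi j hj => ?_
  simp only [Finset.mem_filter, Finset.mem_univ, true_and] at hi hj
  by_contra hij
  have hui : H *ᵥ (hH.eigenvectorBasis i).ofLp = 0 := by
    have h := hH.mulVec_eigenvectorBasis i
    rw [hi, zero_smul] at h
    exact h
  have huj : H *ᵥ (hH.eigenvectorBasis j).ofLp = 0 := by
    have h := hH.mulVec_eigenvectorBasis j
    rw [hj, zero_smul] at h
    exact h
  obtain ⟨ci, hci⟩ := hker _ hui
  obtain ⟨cj, hcj⟩ := hker _ huj
  have horth := Literature.Analysis.Matrix.KyFan.eigenvectorBasis_dotProduct hH i j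
  have hnorm := Literature.Analysis.Matrix.KyFan.eigenvectorBasis_dotProduct hH i i
  rw [if_neg hij, hci, hcj] at horth
  rw [if_pos rfl, hci] at hnorm
  simp only [dotProduct, Finset.sum_const, Finset.card_univ, nsmul_eq_mul] at horth hnorm
  have hnj := Literature.Analysis.Matrix.KyFan.eigenvectorBasis_dotProduct hH j j
  rw [if_pos rfl, hcj] at hnj
  simp only [dotProduct, Finset.sum_const, Finset.card_univ, nsmul_eq_mul] at hnj
  rcases mul_eq_zero.1 horth with h | h
  · rw [h, zero_mul] at hnorm
    exact zero_ne_one hnorm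
  · rcases mul_eq_zero.1 h with h' | h'
    · rw [h', mul_zero, mul_zero] at hnorm
      exact zero_ne_one hnorm
    · rw [h', mul_zero, mul_zero] at hnj
      exact zero_ne_one hnj

omit [DecidableEq E] in
/-- If `H𝟏 = 0` on a non-empty index set then `0` is an eigenvalue. [folklore] -/
private theorem one_le_card_zero [Nonempty V] {H : Matrix V V ℝ} (hH : H.IsHermitian)
    (h1 : H *ᵥ (fun _ => (1 : ℝ)) = 0) :
    1 ≤ (univ.filter fun i => hH.eigenvalues i = 0).card := by
  have hdet : H.det = 0 := by
    rw [← Matrix.exists_mulVec_eq_zero_iff]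
    exact ⟨fun _ => 1, fun h => one_ne_zero (congrFun h (Classical.arbitrary V)), h1⟩
  rw [hH.det_eq_prod_eigenvalues] at hdet
  obtain ⟨i, -, hi⟩ := Finset.prod_eq_zero_iff.1 hdet
  have hi' : hH.eigenvalues i = 0 := by simpa using hi
  exact Finset.card_pos.2 ⟨i, Finset.mem_filter.2 ⟨Finset.mem_univ _, hi'⟩⟩

omit [DecidableEq E] [Fintype V] [DecidableEq V] in
/-- No zero eigenvalue ⇒ `Z` is injective. [folklore] -/
private theorem mulVec_injective_of_card_zero {Z : Matrix κ κ ℝ} (hZ : Z.IsHermitian)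
    (h0 : (univ.filter fun k => hZ.eigenvalues k = 0).card = 0) (y : κ → ℝ) (hy : Z *ᵥ y = 0) :
    y = 0 := by
  have hne : ∀ k, hZ.eigenvalues k ≠ 0 := by
    intro k hk
    have : k ∈ univ.filter fun k => hZ.eigenvalues k = 0 := Finset.mem_filter.2 ⟨Finset.mem_univ _, hk⟩
    rw [Finset.card_eq_zero.1 h0] at this
    exact absurd this (Finset.notMem_empty _)
  have hdet : Z.det ≠ 0 := by
    rw [hZ.det_eq_prod_eigenvalues]
    exact Finset.prod_ne_zero_iff.2 fun k _ => by simpa using hne k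
  exact Matrix.eq_zero_of_mulVec_eq_zero hdet hy

omit [DecidableEq V] [DecidableEq E] [DecidableEq κ] in
/-- **The cycle rank**: with `C` an injective matrix whose columns span `ker B` and `ker Bᵀ` the
constants (connected graph), `|E| + 1 = |V| + |κ|` («the dimension of this nullspace is
`C := |E(G)| − |V(G)| + 1`»). [cite: BronskiDeVilleFerguson2016, §2.1 Definition 2.3 (cycle rank) (arXiv:1508.01507 p0005 L44–L57)] -/
theorem card_edges_add_one [Nonempty V] (B : Matrix V E ℝ) (C : Matrix E κ ℝ) (hBC : B * C = 0)
    (hCinj : ∀ y : κ → ℝ, C *ᵥ y = 0 → y = 0)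
    (hcyc : ∀ f : E → ℝ, B *ᵥ f = 0 → ∃ y : κ → ℝ, C *ᵥ y = f)
    (hconn : ∀ x : V → ℝ, Bᵀ *ᵥ x = 0 → ∃ c : ℝ, x = fun _ => c)
    (hone : Bᵀ *ᵥ (fun _ => (1 : ℝ)) = 0) :
    Fintype.card E + 1 = Fintype.card V + Fintype.card κ := by
  classical
  -- `ker B = range C`, of dimension `|κ|`
  have hker : LinearMap.ker B.mulVecLin = LinearMap.range C.mulVecLin := by
    ext f
    simp only [LinearMap.mem_ker, Matrix.mulVecLin_apply, LinearMap.mem_range]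
    constructor
    · exact hcyc f
    · rintro ⟨y, rfl⟩
      rw [mulVec_mulVec, hBC, zero_mulVec]
  have hCinj' : Function.Injective C.mulVecLin := by
    intro y y' h
    have : C *ᵥ (y - y') = 0 := by
      rw [mulVec_sub]
      exact sub_eq_zero.2 h
    exact sub_eq_zero.1 (hCinj _ this)
  have h1 := LinearMap.finrank_range_add_finrank_ker B.mulVecLin
  rw [hker, LinearMap.finrank_range_of_inj hCinj', Module.finrank_fintype_fun_eq_card,
    Module.finrank_fintype_fun_eq_card] at h1
  -- `ker Bᵀ = span {𝟏}`, of dimension `1`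
  have hkerT : LinearMap.ker Bᵀ.mulVecLin = Submodule.span ℝ {fun _ : V => (1 : ℝ)} := by
    ext x
    simp only [LinearMap.mem_ker, Matrix.mulVecLin_apply, Submodule.mem_span_singleton]
    constructor
    · intro hx
      obtain ⟨c, rfl⟩ := hconn x hx
      exact ⟨c, funext fun _ => by simp⟩
    · rintro ⟨c, rfl⟩
      rw [mulVec_smul, hone, smul_zero]
  have hone_ne : (fun _ : V => (1 : ℝ)) ≠ 0 := fun h => one_ne_zero (congrFun h (Classical.arbitrary V))
  have h2 := LinearMap.finrank_range_add_finrank_ker Bᵀ.mulVecLin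
  rw [hkerT, finrank_span_singleton hone_ne, Module.finrank_fintype_fun_eq_card] at h2
  -- `rank B = rank Bᵀ`
  have hrank : Module.finrank ℝ (LinearMap.range Bᵀ.mulVecLin)
      = Module.finrank ℝ (LinearMap.range B.mulVecLin) := Matrix.rank_transpose B
  omega

end Kernel

/-! ### §5. THEOREM 2.6: `n₊(ℒ_G) = #{γ_e < 0} − n₊(𝒵_G)` (and its mirror image, and the simple
zero), for every connected signed graph with non-singular cycle form -/

section IndexTheorem

variable {V E κ : Type*} [Fintype V] [DecidableEq V] [Fintype E] [DecidableEq E]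
  [Fintype κ] [DecidableEq κ]

omit [Fintype E] [DecidableEq E] [Fintype κ] [DecidableEq κ] in
/-- `n₋ + n₀ + n₊ = |ι|`. [folklore] -/
private theorem card_neg_add_card_zero_add_card_pos {ι : Type*} [Fintype ι] [DecidableEq ι]
    {W : Matrix ι ι ℝ} (hW : W.IsHermitian) :
    (univ.filter fun i => hW.eigenvalues i < 0).card
      + (univ.filter fun i => hW.eigenvalues i = 0).card
      + (univ.filter fun i => 0 < hW.eigenvalues i).card = Fintype.card ι := by
  rw [← Finset.card_union_of_disjoint, ← Finset.card_union_of_disjoint]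
  · rw [← Finset.card_univ]
    congr 1
    ext i
    simp only [Finset.mem_union, Finset.mem_filter, Finset.mem_univ, true_and, iff_true]
    rcases lt_trichotomy (hW.eigenvalues i) 0 with h | h | h
    · exact Or.inl (Or.inl h)
    · exact Or.inl (Or.inr h)
    · exact Or.inr h
  · rw [Finset.disjoint_left]
    intro i h1 h2
    simp only [Finset.mem_union, Finset.mem_filter, Finset.mem_univ, true_and] at h1 h2
    rcases h1 with h1 | h1 <;> linarith
  · rw [Finset.disjoint_left]
    intro i h1 h2
    simp only [Finset.mem_filter, Finset.mem_univ, true_and] at h1 h2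
    linarith

omit [Fintype V] [DecidableEq V] [DecidableEq E] [Fintype κ] [DecidableEq κ] in
/-- With all weights non-zero, `#{γ_e < 0} + #{γ_e > 0} = |E|`. [folklore] -/
private theorem card_neg_add_card_pos_weights {γ : E → ℝ} (hγ : ∀ e, γ e ≠ 0) :
    (univ.filter fun e => γ e < 0).card + (univ.filter fun e => 0 < γ e).card = Fintype.card E := by
  have h := Finset.card_filter_add_card_filter_not (s := (univ : Finset E)) (fun e => γ e < 0)
  rw [Finset.card_univ] at h
  have h2 : (univ.filter fun e => ¬ γ e < 0) = (univ.filter fun e => 0 < γ e) := by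
    ext e
    simp only [Finset.mem_filter, Finset.mem_univ, true_and, not_lt]
    exact ⟨fun h => lt_of_le_of_ne h (Ne.symm (hγ e)), le_of_lt⟩
  rw [h2] at h
  exact h

/-- ★★★ **BRONSKI–DeVILLE–FERGUSON, THEOREM 2.6 (with the simple zero), every topology.**  Let `γ`
be non-zero edge weights, `B` a node–edge matrix whose transpose kills exactly the constants
(`ker Bᵀ = Span(𝟏)`: a connected graph), `C` an edge–cycle matrix with independent columns
spanning `ker B` (a basis of the cycle space), `H` any real symmetric carrier of the cut form
`Σ_e γ_e (Bᵀx)_e²` (`H = BDBᵀ = −ℒ_G`) and `Z` any real symmetric carrier of the cycle form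
`Σ_e (Cy)_e²/γ_e` (`Z = CᵀD⁻¹C = −𝒵_G`, Definition 2.4).  If `Z` is non-singular then
`n₋(H) + n₋(Z) = #{e | γ_e < 0}`, `n₊(H) + n₊(Z) = #{e | γ_e > 0}` and `n₀(H) = 1` — in the
source's notation «`n₊(ℒ_G) = #{e ∈ E | γ_e < 0} − n₊(𝒵_G)`» (`n₊(ℒ_G) = n₋(H)`,
`n₊(𝒵_G) = n₋(Z)`), «it follows from Lemma (sylvester) that the index of `𝒵_G` is independent
of this choice of basis».  (The print carries no non-degeneracy hypothesis; its proof applies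
Haynsworth's Lemma 6.1, which needs `M|_S` non-singular, i.e. `det 𝒵 ≠ 0` — cf. Theorem 2.8.)
[cite: BronskiDeVilleFerguson2016, §2.1 Definitions 2.2–2.4 and Lemma 2.5, §2.2 Theorem 2.6 (eq. (LZ)) and Theorem 2.8, §5 proof of Theorem 2.6, §6 Lemma 6.1 (arXiv:1508.01507 p0005 L25–L134, p0006 L56–L68, p0012 L100–L131, p0014 L5–L20)] -/
theorem index_theorem [Nonempty V] {γ : E → ℝ} (hγ : ∀ e, γ e ≠ 0) (B : Matrix V E ℝ)
    (C : Matrix E κ ℝ) (hBC : B * C = 0) (hCinj : ∀ y : κ → ℝ, C *ᵥ y = 0 → y = 0)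
    (hcyc : ∀ f : E → ℝ, B *ᵥ f = 0 → ∃ y : κ → ℝ, C *ᵥ y = f)
    (hconn : ∀ x : V → ℝ, Bᵀ *ᵥ x = 0 → ∃ c : ℝ, x = fun _ => c)
    (hone : Bᵀ *ᵥ (fun _ => (1 : ℝ)) = 0)
    {H : Matrix V V ℝ} (hH : H.IsHermitian)
    (hHform : ∀ x : V → ℝ, x ⬝ᵥ H *ᵥ x = ∑ e, γ e * ((Bᵀ *ᵥ x) e) ^ 2)
    {Z : Matrix κ κ ℝ} (hZ : Z.IsHermitian)
    (hZform : ∀ y : κ → ℝ, y ⬝ᵥ Z *ᵥ y = ∑ e, ((C *ᵥ y) e) ^ 2 / γ e)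
    (hZ0 : (univ.filter fun k => hZ.eigenvalues k = 0).card = 0) :
    (univ.filter fun i => hH.eigenvalues i < 0).card + (univ.filter fun k => hZ.eigenvalues k < 0).card
        = (univ.filter fun e => γ e < 0).card
      ∧ (univ.filter fun i => 0 < hH.eigenvalues i).card
          + (univ.filter fun k => 0 < hZ.eigenvalues k).card
        = (univ.filter fun e => 0 < γ e).card
      ∧ (univ.filter fun i => hH.eigenvalues i = 0).card = 1 := by
  classical
  have hle1 := card_pos_add_card_pos_le hγ B C hBC hH hHform hZ hZform
  have hle2 := card_neg_add_card_neg_le hγ B C hBC hH hHform hZ hZform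
  have hreg := mulVec_injective_of_card_zero hZ hZ0
  have hker : ∀ x : V → ℝ, H *ᵥ x = 0 → ∃ c : ℝ, x = fun _ => c :=
    fun x hx => ker_const_of_cycleForm_regular hγ B C hBC hcyc hconn hH hHform hZ hZform hreg hx
  have h01 := card_zero_le_one hH hker
  have h1 : H *ᵥ (fun _ => (1 : ℝ)) = 0 := by
    rw [mulVec_eq_incidence B hH hHform, hone]
    have : (fun e => γ e * (0 : E → ℝ) e) = 0 := funext fun e => by simp
    rw [this, mulVec_zero]
  have h10 := one_le_card_zero hH h1
  have htH := card_neg_add_card_zero_add_card_pos hH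
  have htZ := card_neg_add_card_zero_add_card_pos hZ
  have hE := card_neg_add_card_pos_weights hγ
  have hdim := card_edges_add_one B C hBC hCinj hcyc hconn hone
  omega

/-- ★★★ **THEOREM 2.6 as printed (and its mirror)**: `n₊(ℒ_G) = #{γ_e < 0} − n₊(𝒵_G)`, i.e.
`n₋(H) = #{γ_e < 0} − n₋(Z)`, and `n₊(H) = #{γ_e > 0} − n₊(Z)`; in particular «the maximal
number of negative edges a graph can have and still have a stable Laplacian is the cycle number
`C`»: `n₋(H) + |κ| ≥ #{γ_e < 0}` (eq. (LZ) «`n₊(ℒ(G)) ≥ #{e ∈ E | γ_e < 0} − C`»).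
[cite: BronskiDeVilleFerguson2016, §2.2 Theorem 2.6, eq. (LZ) and the paragraph after it (arXiv:1508.01507 p0005 L116–L140, p0006 L1–L8)] -/
theorem card_neg_eq_card_negEdges_sub [Nonempty V] {γ : E → ℝ} (hγ : ∀ e, γ e ≠ 0)
    (B : Matrix V E ℝ) (C : Matrix E κ ℝ) (hBC : B * C = 0)
    (hCinj : ∀ y : κ → ℝ, C *ᵥ y = 0 → y = 0)
    (hcyc : ∀ f : E → ℝ, B *ᵥ f = 0 → ∃ y : κ → ℝ, C *ᵥ y = f)
    (hconn : ∀ x : V → ℝ, Bᵀ *ᵥ x = 0 → ∃ c : ℝ, x = fun _ => c)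
    (hone : Bᵀ *ᵥ (fun _ => (1 : ℝ)) = 0)
    {H : Matrix V V ℝ} (hH : H.IsHermitian)
    (hHform : ∀ x : V → ℝ, x ⬝ᵥ H *ᵥ x = ∑ e, γ e * ((Bᵀ *ᵥ x) e) ^ 2)
    {Z : Matrix κ κ ℝ} (hZ : Z.IsHermitian)
    (hZform : ∀ y : κ → ℝ, y ⬝ᵥ Z *ᵥ y = ∑ e, ((C *ᵥ y) e) ^ 2 / γ e)
    (hZ0 : (univ.filter fun k => hZ.eigenvalues k = 0).card = 0) :
    (univ.filter fun i => hH.eigenvalues i < 0).card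
        = (univ.filter fun e => γ e < 0).card - (univ.filter fun k => hZ.eigenvalues k < 0).card
      ∧ (univ.filter fun i => 0 < hH.eigenvalues i).card
        = (univ.filter fun e => 0 < γ e).card - (univ.filter fun k => 0 < hZ.eigenvalues k).card
      ∧ (univ.filter fun i => hH.eigenvalues i = 0).card = 1
      ∧ (univ.filter fun e => γ e < 0).card
        ≤ (univ.filter fun i => hH.eigenvalues i < 0).card + Fintype.card κ := by
  obtain ⟨h1, h2, h3⟩ := index_theorem hγ B C hBC hCinj hcyc hconn hone hH hHform hZ hZform hZ0
  have htZ := card_neg_add_card_zero_add_card_pos hZ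
  omega

/-- ★★ **The inequalities without non-degeneracy** (any cycle form, singular or not; Remark 2.7:
`n₊(𝒵_G)` is squeezed between the cycle ranks of `G₋` and of `G` minus that of `G₊`, «equivalent
to the inequalities derived previously by the authors»): `n₋(H) + n₋(Z) ≤ #{γ_e < 0}` and
`n₊(H) + n₊(Z) ≤ #{γ_e > 0}`.
[cite: BronskiDeVilleFerguson2016, §2.2 Theorem 2.6 with Remark 2.7 (arXiv:1508.01507 p0005 L116–L134, p0006 L9–L40)] -/
theorem card_add_card_le {γ : E → ℝ} (hγ : ∀ e, γ e ≠ 0) (B : Matrix V E ℝ) (C : Matrix E κ ℝ)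
    (hBC : B * C = 0) {H : Matrix V V ℝ} (hH : H.IsHermitian)
    (hHform : ∀ x : V → ℝ, x ⬝ᵥ H *ᵥ x = ∑ e, γ e * ((Bᵀ *ᵥ x) e) ^ 2)
    {Z : Matrix κ κ ℝ} (hZ : Z.IsHermitian)
    (hZform : ∀ y : κ → ℝ, y ⬝ᵥ Z *ᵥ y = ∑ e, ((C *ᵥ y) e) ^ 2 / γ e) :
    (univ.filter fun i => hH.eigenvalues i < 0).card + (univ.filter fun k => hZ.eigenvalues k < 0).card
        ≤ (univ.filter fun e => γ e < 0).card
      ∧ (univ.filter fun i => 0 < hH.eigenvalues i).card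
          + (univ.filter fun k => 0 < hZ.eigenvalues k).card
        ≤ (univ.filter fun e => 0 < γ e).card :=
  ⟨card_neg_add_card_neg_le hγ B C hBC hH hHform hZ hZform,
    card_pos_add_card_pos_le hγ B C hBC hH hHform hZ hZform⟩

end IndexTheorem

end CycleIntersection

/-! ### §6. THE MODEL: the type of a fixed point of an oscillator network on ANY topology is the
number of long lines minus the negative index of the cycle intersection matrix -/

namespace NonuniformKuramoto

open Literature.LinearAlgebra.Matrix (refMinor refMinor_isHermitian)

variable {n : ℕ} (Kur : NonuniformKuramoto n)

/-- ★★★ **BRONSKI–DeVILLE–FERGUSON IN THE MODEL, EVERY TOPOLOGY.** MODEL: first-order (non-uniform)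
Kuramoto / droop oscillators, `P` symmetric, `Dᵢ > 0`, any natural frequencies, at a configuration
`θ`; the linearised network is given as an oriented weighted EDGE LIST — a node–line matrix `B`
(columns `±1` at the two ends of each line, so `Bᵀ` kills exactly the constants: connected network)
and line weights `γ_e = P_e cos(θ_i − θ_j) ≠ 0` with `xᵀL(θ)x = Σ_e γ_e (Bᵀx)_e²` (`hrep`); `C` a
basis of the cycle space (independent loop flows, `BC = 0`, spanning `ker B`) and `Z` the CYCLE
INTERSECTION MATRIX `Z_kl = Σ_e C_ek C_el / γ_e` (`= −𝒵_G`).  If `Z` is non-singular then `L(θ)`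
has a simple zero and the Jacobian `−D⁻¹L(θ)` has exactly
`#{long lines} − n₋(Z)` characteristic roots in the open right half-plane (the TYPE of `θ`),
`#{short lines} − n₊(Z)` in the open left half-plane and one on the axis; in particular at most
`C = |κ|` (the cycle rank) long lines are compatible with stability («the maximal number of negative
edges a graph can have and still have a stable Laplacian is the cycle number `C`»).  Radial
networks (`C = 0`): type `=` number of long lines; rings (`C = 1`): `Z = Σ 1/γᵢ`.
[cite: BronskiDeVilleFerguson2016, §1.1 (Kuramoto / power-grid reading, «the dimension of the unstable manifold … equal to the number of positive eigenvalues»), §2.2 Theorem 2.6 and eq. (LZ) (arXiv:1508.01507 p0003 L82–L110, p0005 L116–L140, p0006 L1–L8); Chiang1995, §6 Theorem 6.7 (R1)] -/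
theorem type_eq_card_longLines_sub_cycleIndex [NeZero n] (hD : ∀ i, 0 < Kur.D i)
    (hP : ∀ i j, Kur.P i j = Kur.P j i) (θ : Fin n → ℝ)
    {E κ : Type*} [Fintype E] [DecidableEq E] [Fintype κ] [DecidableEq κ]
    (B : Matrix (Fin n) E ℝ) {γ : E → ℝ} (hγ : ∀ e, γ e ≠ 0)
    (hL : (Kur.toDroopNetwork.lap θ).IsHermitian)
    (hrep : ∀ x : Fin n → ℝ,
      x ⬝ᵥ Kur.toDroopNetwork.lap θ *ᵥ x = ∑ e, γ e * ((Bᵀ *ᵥ x) e) ^ 2)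
    (C : Matrix E κ ℝ) (hBC : B * C = 0) (hCinj : ∀ y : κ → ℝ, C *ᵥ y = 0 → y = 0)
    (hcyc : ∀ f : E → ℝ, B *ᵥ f = 0 → ∃ y : κ → ℝ, C *ᵥ y = f)
    (hconn : ∀ x : Fin n → ℝ, Bᵀ *ᵥ x = 0 → ∃ c : ℝ, x = fun _ => c)
    (hone : Bᵀ *ᵥ (fun _ => (1 : ℝ)) = 0)
    {Z : Matrix κ κ ℝ} (hZ : Z.IsHermitian)
    (hZform : ∀ y : κ → ℝ, y ⬝ᵥ Z *ᵥ y = ∑ e, ((C *ᵥ y) e) ^ 2 / γ e)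
    (hZ0 : (univ.filter fun k => hZ.eigenvalues k = 0).card = 0) :
    ((Kur.toDroopNetwork.auxJac θ).map (algebraMap ℝ ℂ)).charpoly.roots.countP (fun μ => 0 < μ.re)
        = (univ.filter fun e => γ e < 0).card - (univ.filter fun k => hZ.eigenvalues k < 0).card
      ∧ ((Kur.toDroopNetwork.auxJac θ).map (algebraMap ℝ ℂ)).charpoly.roots.countP
          (fun μ => μ.re < 0)
        = (univ.filter fun e => 0 < γ e).card - (univ.filter fun k => 0 < hZ.eigenvalues k).card
      ∧ ((Kur.toDroopNetwork.auxJac θ).map (algebraMap ℝ ℂ)).charpoly.roots.countP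
          (fun μ => μ.re = 0) = 1
      ∧ (univ.filter fun e => γ e < 0).card
        ≤ ((Kur.toDroopNetwork.auxJac θ).map (algebraMap ℝ ℂ)).charpoly.roots.countP
            (fun μ => 0 < μ.re) + Fintype.card κ := by
  classical
  obtain ⟨k1, k2, k3, k4⟩ := CycleIntersection.card_neg_eq_card_negEdges_sub hγ B C hBC hCinj hcyc
    hconn hone hL hrep hZ hZform hZ0
  have hrow : ∀ i, ∑ l, Kur.toDroopNetwork.lap θ i l = 0 :=
    fun i => DroopNetwork.sum_lap_row (N := Kur.toDroopNetwork) θ i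
  set i₀ : Fin n := ⟨0, Nat.pos_of_ne_zero (NeZero.ne n)⟩
  have hHm := refMinor_isHermitian hL i₀
  obtain ⟨r1, r2, -, hreg⟩ := RefNode.refMinor_counts hL hrow k3 i₀ hHm
  obtain ⟨t1, t2, t3⟩ := Kur.countP_roots_charpoly_toDroopNetwork_auxJac hP hD θ i₀ hHm hreg
  refine ⟨?_, ?_, t3, ?_⟩
  · rw [t1, r2, k1]
  · rw [t2, r1, k2]
  · rw [t1, r2]; exact k4

end NonuniformKuramoto

namespace ClassicalModel

namespace LosslessSystem

open Literature.LinearAlgebra.Matrix (refMinor refMinor_isHermitian)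

variable {n : ℕ} (S : LosslessSystem n 0)

/-- ★★★ **THE SAME FOR THE CLASSICAL SWING MODEL.** MODEL: `Mᵢδ̈ᵢ + Dᵢδ̇ᵢ = Pᵢ − Σⱼ Cᵢⱼ sin(δᵢ − δⱼ)`,
`C` symmetric, `Mᵢ, Dᵢ > 0`; at a configuration `θ` with the Hesse matrix represented on an
oriented weighted edge list `(B, γ)` (`γ_e = C_e cos(θ_i − θ_j) ≠ 0`, connected), `C'` a cycle
basis and `Z` the cycle intersection matrix, non-singular: the swing Jacobian at `(θ, 0)` has
exactly `#{long lines} − n₋(Z)` roots in the open right half-plane,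
`#{short lines} − n₊(Z) + N` in the open left half-plane, one on the axis.
[cite: BronskiDeVilleFerguson2016, §1.1 and §2.2 Theorem 2.6 (arXiv:1508.01507 p0003 L82–L110, p0005 L116–L140); Chiang1995, §6.3 Theorem 6.1] -/
theorem type_eq_card_longLines_sub_cycleIndex [NeZero n] (hM : ∀ i, 0 < S.M i)
    (hD : ∀ i, 0 < S.D i) (hC : ∀ i j, S.C i j = S.C j i) (θ : Fin n → ℝ)
    {E κ : Type*} [Fintype E] [DecidableEq E] [Fintype κ] [DecidableEq κ]
    (B : Matrix (Fin n) E ℝ) {γ : E → ℝ} (hγ : ∀ e, γ e ≠ 0)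
    (hHess : (S.hessMatrix θ).IsHermitian)
    (hrep : ∀ x : Fin n → ℝ, x ⬝ᵥ S.hessMatrix θ *ᵥ x = ∑ e, γ e * ((Bᵀ *ᵥ x) e) ^ 2)
    (C' : Matrix E κ ℝ) (hBC : B * C' = 0) (hCinj : ∀ y : κ → ℝ, C' *ᵥ y = 0 → y = 0)
    (hcyc : ∀ f : E → ℝ, B *ᵥ f = 0 → ∃ y : κ → ℝ, C' *ᵥ y = f)
    (hconn : ∀ x : Fin n → ℝ, Bᵀ *ᵥ x = 0 → ∃ c : ℝ, x = fun _ => c)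
    (hone : Bᵀ *ᵥ (fun _ => (1 : ℝ)) = 0)
    {Z : Matrix κ κ ℝ} (hZ : Z.IsHermitian)
    (hZform : ∀ y : κ → ℝ, y ⬝ᵥ Z *ᵥ y = ∑ e, ((C' *ᵥ y) e) ^ 2 / γ e)
    (hZ0 : (univ.filter fun k => hZ.eigenvalues k = 0).card = 0) :
    ((S.phaseJac θ).map (algebraMap ℝ ℂ)).charpoly.roots.countP (fun μ => 0 < μ.re)
        = (univ.filter fun e => γ e < 0).card - (univ.filter fun k => hZ.eigenvalues k < 0).card
      ∧ ((S.phaseJac θ).map (algebraMap ℝ ℂ)).charpoly.roots.countP (fun μ => μ.re < 0)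
        = (univ.filter fun e => 0 < γ e).card - (univ.filter fun k => 0 < hZ.eigenvalues k).card + n
      ∧ ((S.phaseJac θ).map (algebraMap ℝ ℂ)).charpoly.roots.countP (fun μ => μ.re = 0) = 1 := by
  classical
  obtain ⟨k1, k2, k3, -⟩ := CycleIntersection.card_neg_eq_card_negEdges_sub hγ B C' hBC hCinj hcyc
    hconn hone hHess hrep hZ hZform hZ0
  have hrow : ∀ i, ∑ l, S.hessMatrix θ i l = 0 := fun i => sum_hessMatrix_row S θ i
  set i₀ : Fin n := ⟨0, Nat.pos_of_ne_zero (NeZero.ne n)⟩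
  have hHm := refMinor_isHermitian hHess i₀
  obtain ⟨r1, r2, -, hreg⟩ := RefNode.refMinor_counts hHess hrow k3 i₀ hHm
  obtain ⟨t1, t2, t3⟩ := S.countP_roots_charpoly_phaseJac_modRotation hM hD hC θ i₀ hHm hreg
  refine ⟨?_, ?_, t3⟩
  · rw [t1, r2, k1]
  · rw [t2, r1, k2]

end LosslessSystem

end ClassicalModel

end Literature.MathematicalPhysics.PowerSystems
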